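import Summits.KontsevichZagierPeriods.KontsevichZagierPeriods.Theses.FurushoPentagon
import Literature.NumberTheory.Transcendental.KZCubicalCalculus
import Literature.NumberTheory.Transcendental.AyoubPeriodSeries
import Literature.NumberTheory.Transcendental.AyoubPeriodSeriesPiAlgebraic
import Literature.NumberTheory.Transcendental.AyoubPeriodSeriesKernel
import Mathlib.RingTheory.MvPowerSeries.Rename

/-!
# `SectorToKernel`, line `effective-cube-surjection`: complexification of a convergent algebraic
real power series into Ayoub's `𝒪_{ℚ-alg}(𝔻̄^∞)` (helper `rsf_complexify` of stub S3)

Helper lemma for the lead's assembly of `stub_realStokesForm` of the crux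
`FurushoPentagon.SectorToKernel` (stmt-KontsevichZagierPeriods-10813).

Let `F ∈ ℝ⟦x₀, …, x_{m-1}⟧` be a real power series with a summable majorant
`∑ₐ |Fₐ| ρ^{|a|} < ∞` of polyradius `ρ > 1` and a non-zero formal polynomial relation `P(F) = 0`,
`P ∈ ℚ[x][Y]`. Read `F` in `ℂ⟦z₀, z₁, …⟧ = CSeries` along `Fin.val : Fin m ↪ ℕ`
(`MvPowerSeries.rename`, then `MvPowerSeries.map (algebraMap ℝ ℂ)`); call the result `Fc`. We prove:

* `Fc` depends only on `z₀, …, z_{m-1}` (a coefficient index with a non-zero exponent at some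
  `l ≥ m` is not in the range of `Finsupp.embDomain Fin.valEmbedding`, where the renamed series has
  zero coefficients, `MvPowerSeries.coeff_rename_eq_zero`);
* `Fc` has polyradius of convergence `> 1` (the family `a ↦ ‖coeff a Fc‖ ρ^{|a|}` vanishes off the
  range of the injection `Finsupp.embDomain Fin.valEmbedding` and pulls back to the given summable
  majorant, `Function.Injective.summable_iff`);
* `Fc` is algebraic over `ℚ(z)`: the renamed polynomial `P_ℕ := P.map (rename Fin.val)` is non-zero
  and kills `Fc`, because complexification-and-renaming is a ring homomorphism
  `Ψ : ℝ⟦x⟧ → ℂ⟦z⟧` compatible with the coefficient embeddings `ℚ[x] → ℝ⟦x⟧`, `ℚ[z] → ℂ⟦z⟧`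
  (`Polynomial.hom_eval₂`, `Polynomial.eval₂_map`, `MvPolynomial.ringHom_ext`);
* hence `Fc ∈ 𝒪_{ℚ-alg}(𝔻̄^∞) = Oan (Rat.castHom ℂ)`, and Ayoub's integral
  `intC Fc = ∑ₐ (Fc)ₐ ∏ᵢ (aᵢ + 1)⁻¹` is the real termwise sum `∑_b F_b ∏ⱼ (bⱼ + 1)⁻¹`
  (reindexing the `tsum` along the injection, `Function.Injective.tsum_eq`, `Complex.ofReal_tsum`).

All of this is bookkeeping (folklore); the objects are those of J. Ayoub, *La version relative de la
conjecture des périodes de Kontsevich–Zagier revisitée*, §1.1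
(`Literature/NumberTheory/Transcendental/AyoubPeriodSeries.lean`).
-/

noncomputable section

namespace Summit.KontsevichZagierPeriods.FurushoPentagon.SectorToKernel

section Helpers

open MvPowerSeries (coeff)
open Literature.NumberTheory.Transcendental
open AyoubRel (CSeries Oan intC DependsOnlyOnLT HasPolyradiusGtOne IsAlgebraicOverRatFunc
  polyToCSeries)

variable {m : ℕ}

/-! ## The range of `Finsupp.embDomain Fin.valEmbedding` -/

/-- A coefficient index `a : ℕ →₀ ℕ` comes from `Fin m →₀ ℕ` along `Fin.val` iff all its exponents
at indices `≥ m` vanish. [folklore] -/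
theorem rcx_mem_range_embDomain_iff (a : ℕ →₀ ℕ) :
    a ∈ Set.range (Finsupp.embDomain (Fin.valEmbedding : Fin m ↪ ℕ)) ↔ ∀ i, m ≤ i → a i = 0 := by
  rw [Finsupp.mem_range_embDomain_iff]
  constructor
  · intro h i hi
    by_contra hne
    have hmem : i ∈ Set.range (Fin.valEmbedding : Fin m ↪ ℕ) :=
      h (by rw [Finset.mem_coe, Finsupp.mem_support_iff]; exact hne)
    obtain ⟨j, hj⟩ := hmem
    rw [Fin.valEmbedding_apply] at hj
    exact absurd j.2 (by rw [hj]; exact not_lt.2 hi)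
  · intro h i hi
    rw [Finset.mem_coe, Finsupp.mem_support_iff] at hi
    have him : i < m := by
      by_contra hlt
      exact hi (h i (not_lt.1 hlt))
    exact ⟨⟨i, him⟩, rfl⟩

/-- The ranges of `Finsupp.embDomain e` and `Finsupp.mapDomain e` agree (`e = Fin.valEmbedding`).
[folklore] -/
theorem rcx_range_embDomain_eq_range_mapDomain :
    Set.range (Finsupp.embDomain (Fin.valEmbedding : Fin m ↪ ℕ) : (Fin m →₀ ℕ) → ℕ →₀ ℕ) =
      Set.range (Finsupp.mapDomain (Fin.valEmbedding : Fin m ↪ ℕ) : (Fin m →₀ ℕ) → ℕ →₀ ℕ) := by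
  congr 1
  funext b
  exact Finsupp.embDomain_eq_mapDomain _ _

/-- The total degree is invariant under `Finsupp.embDomain`. [folklore] -/
theorem rcx_degree_embDomain (b : Fin m →₀ ℕ) :
    (Finsupp.embDomain (Fin.valEmbedding : Fin m ↪ ℕ) b).degree = b.degree := by
  rw [Finsupp.embDomain_eq_mapDomain, Finsupp.degree_mapDomain]

/-! ## Coefficients of the complexified series -/

/-- On the range of `Fin.val`, the coefficients of the complexified series are the (real)
coefficients of `F`. [folklore] -/
theorem rcx_coeff_embDomain (F : MvPowerSeries (Fin m) ℝ) (b : Fin m →₀ ℕ) :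
    coeff (Finsupp.embDomain (Fin.valEmbedding : Fin m ↪ ℕ) b)
      (MvPowerSeries.map (algebraMap ℝ ℂ)
        (MvPowerSeries.rename (Fin.valEmbedding : Fin m ↪ ℕ) F)) = ((coeff b F : ℝ) : ℂ) := by
  rw [MvPowerSeries.coeff_map, MvPowerSeries.coeff_embDomain_rename]
  rfl

/-- Off the range of `Fin.val`, the coefficients of the complexified series vanish. [folklore] -/
theorem rcx_coeff_eq_zero (F : MvPowerSeries (Fin m) ℝ) {a : ℕ →₀ ℕ}
    (ha : a ∉ Set.range (Finsupp.embDomain (Fin.valEmbedding : Fin m ↪ ℕ))) :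
    coeff a (MvPowerSeries.map (algebraMap ℝ ℂ)
      (MvPowerSeries.rename (Fin.valEmbedding : Fin m ↪ ℕ) F)) = 0 := by
  rw [rcx_range_embDomain_eq_range_mapDomain] at ha
  rw [MvPowerSeries.coeff_map, MvPowerSeries.coeff_rename_eq_zero _ F ha, map_zero]

/-! ## Dependence on finitely many variables and polyradius -/

/-- The complexified series depends only on `z₀, …, z_{m-1}`. [folklore] -/
theorem rcx_dependsOnlyOnLT (F : MvPowerSeries (Fin m) ℝ) :
    DependsOnlyOnLT (MvPowerSeries.map (algebraMap ℝ ℂ)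
      (MvPowerSeries.rename (Fin.valEmbedding : Fin m ↪ ℕ) F)) m := by
  rintro a ⟨i, hi, hai⟩
  refine rcx_coeff_eq_zero F fun hmem => hai ?_
  exact (rcx_mem_range_embDomain_iff a).1 hmem i hi

/-- The complexified series has polyradius of convergence `> 1`: its majorant at polyradius `ρ` is
the given summable majorant of `F`, reindexed along `Fin.val`. [folklore] -/
theorem rcx_hasPolyradiusGtOne (F : MvPowerSeries (Fin m) ℝ) {ρ : ℝ} (hρ : 1 < ρ)
    (hF : Summable fun a : Fin m →₀ ℕ => |coeff a F| * ρ ^ (a.sum fun _ e => e)) :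
    HasPolyradiusGtOne (MvPowerSeries.map (algebraMap ℝ ℂ)
      (MvPowerSeries.rename (Fin.valEmbedding : Fin m ↪ ℕ) F)) := by
  refine ⟨ρ, hρ, ?_⟩
  rw [← (Finsupp.embDomain_injective (Fin.valEmbedding : Fin m ↪ ℕ)).summable_iff
    (f := fun a : ℕ →₀ ℕ => ‖coeff a (MvPowerSeries.map (algebraMap ℝ ℂ)
      (MvPowerSeries.rename (Fin.valEmbedding : Fin m ↪ ℕ) F))‖ * ρ ^ (Finsupp.degree a)) ?_]
  · refine hF.congr fun b => ?_
    simp only [Function.comp_apply, rcx_coeff_embDomain, rcx_degree_embDomain, Complex.norm_real,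
      Real.norm_eq_abs]
    rfl
  · intro a ha
    rw [rcx_coeff_eq_zero F ha, norm_zero, zero_mul]

/-! ## Algebraicity over `ℚ(z)` -/

/-- Complexification-and-renaming `Ψ : ℝ⟦x₀,…,x_{m-1}⟧ → ℂ⟦z⟧` intertwines the coefficient
embeddings: `ℚ[x] → ℚ[z] → ℂ⟦z⟧` (rename along `Fin.val`, then Ayoub's `polyToCSeries`) equals
`ℚ[x] → ℝ⟦x⟧ → ℂ⟦z⟧`. Checked on constants and variables (`MvPolynomial.ringHom_ext`). [folklore] -/
theorem rcx_ringHom_comp :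
    (polyToCSeries (Rat.castHom ℂ)).comp
        (MvPolynomial.rename ((↑) : Fin m → ℕ) :
          MvPolynomial (Fin m) ℚ →ₐ[ℚ] MvPolynomial ℕ ℚ).toRingHom =
      ((MvPowerSeries.map (algebraMap ℝ ℂ)).comp
          (MvPowerSeries.rename (Fin.valEmbedding : Fin m ↪ ℕ) :
            MvPowerSeries (Fin m) ℝ →ₐ[ℝ] MvPowerSeries ℕ ℝ).toRingHom).comp
        ((MvPolynomial.coeToMvPowerSeries.ringHom (σ := Fin m) (R := ℝ)).comp
          (MvPolynomial.map (algebraMap ℚ ℝ))) := by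
  refine MvPolynomial.ringHom_ext (fun q => ?_) (fun j => ?_)
  · simp [polyToCSeries]
  · simp [polyToCSeries]

/-- The complexified series is algebraic over `ℚ(z)`: the renamed relation `P.map (rename Fin.val)`
is non-zero and kills it. [folklore] -/
theorem rcx_isAlgebraicOverRatFunc (F : MvPowerSeries (Fin m) ℝ)
    (P : Polynomial (MvPolynomial (Fin m) ℚ)) (hP : P ≠ 0)
    (hPF : Polynomial.eval₂ ((MvPolynomial.coeToMvPowerSeries.ringHom (σ := Fin m) (R := ℝ)).comp
      (MvPolynomial.map (algebraMap ℚ ℝ))) F P = 0) :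
    IsAlgebraicOverRatFunc (Rat.castHom ℂ) (MvPowerSeries.map (algebraMap ℝ ℂ)
      (MvPowerSeries.rename (Fin.valEmbedding : Fin m ↪ ℕ) F)) := by
  refine ⟨P.map (MvPolynomial.rename ((↑) : Fin m → ℕ) :
      MvPolynomial (Fin m) ℚ →ₐ[ℚ] MvPolynomial ℕ ℚ).toRingHom, ?_, ?_⟩
  · exact (Polynomial.map_ne_zero_iff
      (MvPolynomial.rename_injective _ Fin.val_injective)).2 hP
  · rw [Polynomial.eval₂_map, rcx_ringHom_comp]
    have h := Polynomial.hom_eval₂ P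
      ((MvPolynomial.coeToMvPowerSeries.ringHom (σ := Fin m) (R := ℝ)).comp
        (MvPolynomial.map (algebraMap ℚ ℝ)))
      ((MvPowerSeries.map (algebraMap ℝ ℂ)).comp
        (MvPowerSeries.rename (Fin.valEmbedding : Fin m ↪ ℕ) :
          MvPowerSeries (Fin m) ℝ →ₐ[ℝ] MvPowerSeries ℕ ℝ).toRingHom) F
    rw [hPF, map_zero] at h
    exact h.symm

/-! ## Ayoub's integral of the complexified series -/

/-- `intC` of the complexified series is the real termwise sum `∑_b F_b ∏ⱼ (bⱼ + 1)⁻¹`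
(reindexing the `tsum` along the injection `Finsupp.embDomain Fin.valEmbedding`; no summability
needed). [folklore] -/
theorem rcx_intC (F : MvPowerSeries (Fin m) ℝ) :
    intC (MvPowerSeries.map (algebraMap ℝ ℂ)
      (MvPowerSeries.rename (Fin.valEmbedding : Fin m ↪ ℕ) F)) =
      ((∑' a : Fin m →₀ ℕ, coeff a F * a.prod (fun _ e => ((e : ℝ) + 1)⁻¹) : ℝ) : ℂ) := by
  rw [AyoubRel.intC, Complex.ofReal_tsum,
    ← (Finsupp.embDomain_injective (Fin.valEmbedding : Fin m ↪ ℕ)).tsum_eq ?_]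
  · refine tsum_congr fun b => ?_
    rw [rcx_coeff_embDomain]
    change _ * (Finsupp.embDomain _ b).prod (fun _ n => ((n : ℂ) + 1)⁻¹) = _
    rw [Finsupp.prod_embDomain]
    simp only [Finsupp.prod]
    push_cast
    rfl
  · intro a ha
    by_contra h
    exact ha (by simp only [rcx_coeff_eq_zero F h, zero_mul])

end Helpers

open Set MeasureTheory
open Literature.NumberTheory.Transcendental
open Literature.NumberTheory.Transcendental.KZ hiding cubicalSpan
open Summit.KontsevichZagierPeriods.KontsevichZagierPeriods.Theses.FurushoPentagon
open AyoubRel (CSeries Oan intC relAC pdz restrC kSpan DependsOnlyOnLT HasPolyradiusGtOne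
  IsAlgebraicOverRatFunc)

/-- **Complexification (helper C of `stub_realStokesForm`).** A real power series `F` in `m`
variables with a summable majorant of polyradius `ρ > 1` and a non-zero formal polynomial relation
`P(F) = 0` over `ℚ[x]`, read in `ℂ⟦z₀, z₁, …⟧` along `Fin.val`, lies in Ayoub's
`𝒪_{ℚ-alg}(𝔻̄^∞)`, depends only on `z₀, …, z_{m-1}`, and its Ayoub integral `∫_{[0,1]^∞}` is the
real termwise sum `∑_b F_b ∏ⱼ (bⱼ + 1)⁻¹`. [folklore] -/
theorem rsf_complexify : ∀ (m : ℕ) (F : MvPowerSeries (Fin m) ℝ) (ρ : ℝ), 1 < ρ → Summable (fun a : Fin m →₀ ℕ => |MvPowerSeries.coeff a F| * ρ ^ (a.sum fun _ e => e)) → ∀ (P : Polynomial (MvPolynomial (Fin m) ℚ)), P ≠ 0 → Polynomial.eval₂ ((MvPolynomial.coeToMvPowerSeries.ringHom (σ := Fin m) (R := ℝ)).comp (MvPolynomial.map (algebraMap ℚ ℝ))) F P = 0 → MvPowerSeries.map (algebraMap ℝ ℂ) (MvPowerSeries.rename (Fin.valEmbedding : Fin m ↪ ℕ) F) ∈ Oan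 (Rat.castHom ℂ) ∧ DependsOnlyOnLT (MvPowerSeries.map (algebraMap ℝ ℂ) (MvPowerSeries.rename (Fin.valEmbedding : Fin m ↪ ℕ) F)) m ∧ intC (MvPowerSeries.map (algebraMap ℝ ℂ) (MvPowerSeries.rename (Fin.valEmbedding : Fin m ↪ ℕ) F)) = ((∑' a : Fin m →₀ ℕ, MvPowerSeries.coeff a F * a.prod (fun _ e => ((e : ℝ) + 1)⁻¹) : ℝ) : ℂ) := by
  intro m F ρ hρ hF P hP hPF
  exact ⟨⟨⟨m, rcx_dependsOnlyOnLT F⟩, rcx_hasPolyradiusGtOne F hρ hF,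
    rcx_isAlgebraicOverRatFunc F P hP hPF⟩, rcx_dependsOnlyOnLT F, rcx_intC F⟩

end Summit.KontsevichZagierPeriods.FurushoPentagon.SectorToKernel
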